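import Literature.Barriers.PneNP.TSPExtensionComplexityScope
import Literature.Barriers.PneNP.TSPExtensionComplexityProofs
import HarnessLib

/-!
# Discharge of `TSPExtensionComplexityNarrow` — the extension-complexity barrier on FMPTW's own
technique class ("an LP that solves the TSP")

`theorem TSPExtensionComplexityNarrow_holds : TSPExtensionComplexityNarrow`, by composing two
results already in the tree (no new definitions, no new named facts; net effect: the audit form
of the barrier fact stops being literature debt):

* `tspExtensionComplexityNarrow_iff : TSPExtensionComplexityNarrow ↔ TSPExtensionComplexity`
  (`TSPExtensionComplexityScope.lean`): a slack-form LP over the edge variables of `K_n` whose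
  projection contains the tours and which returns the optimal tour length for every nonnegative
  weight vector IS an extended formulation of `TSP(n)` of the same size
  (`lpSolvesTSPOn_nonneg_iff`, one added equation `Σ_e x_e = n` and a separating hyperplane);
* `TSPExtensionComplexity_holds` (`TSPExtensionComplexityProofs.lean`): FMPTW Thm. 12,
  every extended formulation of `TSP(n)` has at least `2^{c√n}` inequalities for `n ≥ 900`,
  `c = log(3/2) / (10 log 2)` — proved in the tree from the duality-free rectangle covering
  bound (`…Rectangles.lean`), Kaibel–Weltge's count (`…KaibelWeltge.lean`) and the gadget tours
  (`…Gadget*.lean`).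

The headline reading "no polynomial-size LP solves the TSP" (FMPTW §1, in their own sense of
"solves", §1.1) is restated unconditionally as `no_polysize_lp_solves_holds`.

## References

* [FioriniEtAl2015] S. Fiorini, S. Massar, S. Pokutta, H. R. Tiwary, R. de Wolf, *Exponential
  lower bounds for polytopes in combinatorial optimization*, J. ACM 62 (2015) = arXiv:1111.0837
  (held; locators re-read with `lit read arxiv:1111.0837`): §1.1 (PDF p. 3: "When we say that an
  LP solves the problem, we mean that there exists an LP over this set of variables plus extra
  variables that returns the correct objective function value for all instances over the same
  number of cities"), Thm. 12 (PDF p. 11: "The extension complexity of the TSP polytope `TSP(n)`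
  is `2^{Ω(n^{1/2})}`").
* [Yannakakis1991] M. Yannakakis, *Expressing combinatorial optimization problems by linear
  programs*, J. Comput. Syst. Sci. 43 (1991) 441–466: p. 442 (the polynomial-size LPs "for the
  TSP" whose refutation motivated the question; context of the barrier entry, not used in the
  proof).
-/

namespace Literature.Barriers.PneNP

open Filter

/-- **The extension-complexity barrier on its exact technique class holds** (FMPTW 2015, Thm. 12,
read through §1.1's notion of "an LP that solves the TSP"): there is `c > 0` such that for all
large `n`, every slack-form LP over the edge variables of `K_n` plus extra variables whose
projection contains the tours and which returns the optimal tour length for every nonnegative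
weight vector has at least `2^{c√n}` inequalities. Composition of `tspExtensionComplexityNarrow_iff`
with the proved `TSPExtensionComplexity_holds`.
[cite: FioriniEtAl2015, §1.1 (PDF p. 3) and Thm. 12 (PDF p. 11)] -/
theorem TSPExtensionComplexityNarrow_holds : TSPExtensionComplexityNarrow :=
  tspExtensionComplexityNarrow_iff.2 TSPExtensionComplexity_holds

/-- **No polynomial-size LP solves the TSP**, unconditionally (FMPTW's headline, §1, in their own
sense of "solves", §1.1): for every exponent `K`, for all large `n`, no slack-form LP over the
edge variables of `K_n` with at most `n^K + K` inequalities contains the tours and optimises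
every nonnegative instance exactly. [cite: FioriniEtAl2015, §1–1.1 (PDF p. 3) and Thm. 12 (PDF p. 11)] -/
theorem no_polysize_lp_solves_holds (K : ℕ) :
    ∀ᶠ n : ℕ in atTop, ∀ r ≤ n ^ K + K, ¬ LPSolvesTSPOn n (nonnegWeights n) r :=
  TSPExtensionComplexity_holds.no_polysize_lp_solves K

end Literature.Barriers.PneNP
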